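import Mathlib
import HarnessLib
import Literature.Analysis.OperatorTheory.SchurComplementCount

/-!
# Approximate-inverse (residual) Schur-complement inertia certificate for a pencil with diagonal Gram matrix

A second certificate shape for the nonnegativity of a large sparse real symmetric block form
`K = [[A, B], [Bᵀ, D]]` (free block `A`, pinned block `D`) on a constraint subspace of the pinned
variable, companion to `SchurComplementPolynomialBound.lean` (`D − Bᵀ p(A) B ⪰ 0` with a certified
polynomial `p ≥ 1/x`). Here NO function of `A` is applied exactly: the verifier supplies ANY matrix `Y`
(in practice a floating-point approximation of `A⁻¹B`, rounded to rationals) and checks, in exact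
arithmetic, one sparse product `A Y`, the residual `R = B − A Y`, and the positive semidefiniteness of
the explicit `n × n` matrix
`D + Yᵀ A Y − Yᵀ B − Bᵀ Y − c⁻¹ Rᵀ G⁻¹ R  (+ Σ_j t_j q_j q_jᵀ)`,
where `c G ⪯ A`, `G = diagonal g`, `g > 0`, `c > 0` (the "corner" bound of the free block in an orthogonal,
unnormalised basis). Then `(x ⊕ y)ᵀ K (x ⊕ y) ≥ 0` whenever `q_j ⬝ y = 0` for all `j`.
Mechanism (Krawczyk/Rump-style a-posteriori verification; Haynsworth inertia additivity): with the shift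
`x' = x + Y y`, `(x ⊕ y)ᵀ K (x ⊕ y) = x'ᵀ A x' + 2 x'ᵀ R y + yᵀ (D + YᵀAY − YᵀB − BᵀY) y`, and
`x'ᵀ A x' + 2 x'ᵀ w ≥ c x'ᵀ G x' + 2 x'ᵀ w ≥ −c⁻¹ wᵀ G⁻¹ w` coordinatewise (`G` diagonal), `w = R y`.
If `Y = A⁻¹B` exactly, `R = 0` and the certificate matrix is the Schur complement `D − BᵀA⁻¹B`.
* `fromBlocks_dotProduct_eq_shift` — the shift identity.
* `pencil_completion_sq` — `c xᵀGx + 2 xᵀw + c⁻¹ wᵀG⁻¹w ≥ 0`.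
* `fromBlocks_dotProduct_nonneg_of_residual_cert` — the certificate.
References: Haynsworth, Linear Algebra Appl. 1 (1968) 73–81, Thm 1 [Haynsworth1968]; Horn–Johnson,
*Matrix Analysis* (2013) Thm 4.5.8 / §7.7 [HornJohnson2013]; Rump, Acta Numerica 19 (2010) 287–449, §10
(verification with approximate inverses) [Rump2010Verification].
-/

namespace Literature.Analysis.OperatorTheory

open Matrix
open scoped Matrix

variable {m n : Type*} [Fintype m] [Fintype n] [DecidableEq m]

omit [DecidableEq m] in
/-- **Shift identity.** For symmetric `A` and any `Y`, with `x' = x + Y y` and `R = B − A Y`: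
`(x ⊕ y)ᵀ [[A, B], [Bᵀ, D]] (x ⊕ y) = x'ᵀ A x' + 2 x'ᵀ R y + yᵀ (D + YᵀAY − YᵀB − BᵀY) y`.
[cite: Haynsworth1968, Thm 1] -/
theorem fromBlocks_dotProduct_eq_shift (A : Matrix m m ℝ) (B : Matrix m n ℝ) (D : Matrix n n ℝ)
    (Y : Matrix m n ℝ) (hA : Aᵀ = A) (x : m → ℝ) (y : n → ℝ) :
    (Sum.elim x y) ⬝ᵥ (fromBlocks A B Bᵀ D *ᵥ Sum.elim x y) =
      (x + Y *ᵥ y) ⬝ᵥ (A *ᵥ (x + Y *ᵥ y)) + 2 * ((x + Y *ᵥ y) ⬝ᵥ ((B - A * Y) *ᵥ y)) +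
        y ⬝ᵥ ((D + Yᵀ * A * Y - Yᵀ * B - Bᵀ * Y) *ᵥ y) := by
  have hAY : ∀ u v : m → ℝ, u ⬝ᵥ (A *ᵥ v) = v ⬝ᵥ (A *ᵥ u) := fun u v => by
    rw [dotProduct_mulVec, ← mulVec_transpose, hA, dotProduct_comm]
  have e1 : (Y *ᵥ y) ⬝ᵥ (A *ᵥ x) = x ⬝ᵥ (A *ᵥ (Y *ᵥ y)) := hAY _ _
  have e2 : y ⬝ᵥ (Bᵀ *ᵥ x) = x ⬝ᵥ (B *ᵥ y) := by
    rw [dotProduct_mulVec, ← mulVec_transpose, transpose_transpose, dotProduct_comm]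
  have e3 : y ⬝ᵥ ((Yᵀ * A * Y) *ᵥ y) = (Y *ᵥ y) ⬝ᵥ (A *ᵥ (Y *ᵥ y)) := by
    rw [← mulVec_mulVec, ← mulVec_mulVec, dotProduct_mulVec y Yᵀ, ← mulVec_transpose,
      transpose_transpose]
  have e4 : y ⬝ᵥ ((Yᵀ * B) *ᵥ y) = (Y *ᵥ y) ⬝ᵥ (B *ᵥ y) := by
    rw [← mulVec_mulVec, dotProduct_mulVec y Yᵀ, ← mulVec_transpose, transpose_transpose]
  have e5 : y ⬝ᵥ ((Bᵀ * Y) *ᵥ y) = (Y *ᵥ y) ⬝ᵥ (B *ᵥ y) := by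
    rw [← mulVec_mulVec, dotProduct_mulVec y Bᵀ, ← mulVec_transpose, transpose_transpose,
      dotProduct_comm]
  have e6 : (Y *ᵥ y) ⬝ᵥ ((A * Y) *ᵥ y) = (Y *ᵥ y) ⬝ᵥ (A *ᵥ (Y *ᵥ y)) := by rw [← mulVec_mulVec]
  have e7 : x ⬝ᵥ ((A * Y) *ᵥ y) = x ⬝ᵥ (A *ᵥ (Y *ᵥ y)) := by rw [← mulVec_mulVec]
  rw [fromBlocks_mulVec]
  simp only [Sum.elim_comp_inl, Sum.elim_comp_inr, sumElim_dotProduct_sumElim]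
  simp only [dotProduct_add, add_dotProduct, mulVec_add, add_mulVec, sub_mulVec, dotProduct_sub,
    Matrix.mulVec_add]
  try rw [e1]
  try rw [e2]
  try rw [e3]
  try rw [e4]
  try rw [e5]
  try rw [e6]
  try rw [e7]
  try rw [hAY (Y *ᵥ y) x]
  ring

/-- **Coordinatewise completion of squares for a diagonal pencil**: for `g > 0`, `c > 0`,
`c (xᵀ G x) + 2 xᵀ w + c⁻¹ (wᵀ G⁻¹ w) ≥ 0` with `G = diagonal g`
(`= Σ_i (c g_i)(x_i + w_i/(c g_i))²`). [cite: HornJohnson2013, Thm 4.5.8] -/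
theorem pencil_completion_sq (g : m → ℝ) (c : ℝ) (hg : ∀ i, 0 < g i) (hc : 0 < c)
    (x w : m → ℝ) :
    0 ≤ c * (x ⬝ᵥ (diagonal g *ᵥ x)) + 2 * (x ⬝ᵥ w) +
      c⁻¹ * (w ⬝ᵥ (diagonal (fun i => (g i)⁻¹) *ᵥ w)) := by
  simp only [mulVec_diagonal, dotProduct, Finset.mul_sum, ← Finset.sum_add_distrib]
  refine Finset.sum_nonneg fun i _ => ?_
  have hgi := hg i
  have hcg : 0 < c * g i := mul_pos hc hgi
  have key : c * (x i * (g i * x i)) + 2 * (x i * w i) + c⁻¹ * (w i * ((g i)⁻¹ * w i)) =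
      (c * g i) * (x i + w i / (c * g i)) ^ 2 := by
    field_simp
    ring
  rw [key]
  positivity

/-- **Residual (approximate-inverse) Schur certificate for a pencil.** Let `K = [[A, B], [Bᵀ, D]]` be real
with `A` symmetric and `c • diagonal g ⪯ A` (`g > 0`, `c > 0`). For ANY `Y : m × n` put `R = B − A Y`. If
`D + YᵀAY − YᵀB − BᵀY − c⁻¹ Rᵀ (diagonal g)⁻¹ R + Σ_j t_j q_j q_jᵀ ⪰ 0`, then
`(x ⊕ y)ᵀ K (x ⊕ y) ≥ 0` whenever `q_j ⬝ y = 0` for all `j`. (With `Y = A⁻¹B`: `R = 0`, Haynsworth.)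
[cite: Haynsworth1968, Thm 1] [cite: HornJohnson2013, Thm 4.5.8] -/
theorem fromBlocks_dotProduct_nonneg_of_residual_cert {k : ℕ} (A : Matrix m m ℝ) (B : Matrix m n ℝ)
    (D : Matrix n n ℝ) (g : m → ℝ) (c : ℝ) (Y : Matrix m n ℝ) (t : Fin k → ℝ) (q : Fin k → n → ℝ)
    (hg : ∀ i, 0 < g i) (hc : 0 < c) (hA : Aᵀ = A) (hAc : (A - c • diagonal g).PosSemidef)
    (hcert : (D + Yᵀ * A * Y - Yᵀ * B - Bᵀ * Y -
        c⁻¹ • ((B - A * Y)ᵀ * diagonal (fun i => (g i)⁻¹) * (B - A * Y)) +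
        ∑ j, t j • vecMulVec (q j) (q j)).PosSemidef)
    (x : m → ℝ) (y : n → ℝ) (hy : ∀ j, q j ⬝ᵥ y = 0) :
    0 ≤ (Sum.elim x y) ⬝ᵥ (fromBlocks A B Bᵀ D *ᵥ Sum.elim x y) := by
  rw [fromBlocks_dotProduct_eq_shift A B D Y hA x y]
  set x' := x + Y *ᵥ y with hx'
  set R := B - A * Y with hR
  -- the certificate, read on `{q_j ⬝ y = 0}`
  have h1 : 0 ≤ y ⬝ᵥ ((D + Yᵀ * A * Y - Yᵀ * B - Bᵀ * Y -
      c⁻¹ • (Rᵀ * diagonal (fun i => (g i)⁻¹) * R)) *ᵥ y) :=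
    dotProduct_mulVec_nonneg_of_posSemidef_add _ (∑ j, t j • vecMulVec (q j) (q j)) q hcert
      (fun y hy => dotProduct_sum_vecMulVec_mulVec_eq_zero t q y hy) y hy
  -- the free-block corner bound
  have h2 : c * (x' ⬝ᵥ (diagonal g *ᵥ x')) ≤ x' ⬝ᵥ (A *ᵥ x') := by
    have h := hAc.dotProduct_mulVec_nonneg x'
    rw [star_trivial, sub_mulVec, dotProduct_sub, smul_mulVec, dotProduct_smul, smul_eq_mul] at h
    linarith
  -- completion of squares with `w = R y`
  have h3 := pencil_completion_sq g c hg hc x' (R *ᵥ y)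
  have e : (R *ᵥ y) ⬝ᵥ (diagonal (fun i => (g i)⁻¹) *ᵥ (R *ᵥ y)) =
      y ⬝ᵥ ((Rᵀ * diagonal (fun i => (g i)⁻¹) * R) *ᵥ y) := by
    rw [← mulVec_mulVec, ← mulVec_mulVec, dotProduct_mulVec y Rᵀ, ← mulVec_transpose,
      transpose_transpose]
  rw [sub_mulVec, dotProduct_sub, smul_mulVec, dotProduct_smul, smul_eq_mul, ← e] at h1
  linarith

end Literature.Analysis.OperatorTheory
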